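import Mathlib
import Summits.ValiantsHypothesis.ValiantsHypothesis.Theorems.RigidityForcesSymmetryRankRigidMinimalReprLaplaceFiveSectorSplit
import Summits.ValiantsHypothesis.ValiantsHypothesis.Theorems.RigidityForcesSymmetryRankRigidMinimalReprLaplaceFiveStarExchange

/-!
# ValiantsHypothesis / RigidityForcesSymmetry — crux `LaplaceOptimalFive` (stmt-ValiantsHypothesis-24813), crux idea
`young-shadow` (K1) on the star: **READING A WHOLE SIDE-SYMMETRIC STAR DECOMPOSITION IN LETTER CURRENCY**
(memo `NOTE-p4g15-24813-K1-star.md` §9 «Currency»; memo `NOTE-p4g16-24813-LemmaK-kernel.md` r2 §4 (iv) wiring)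

For a side-symmetric pair-split decomposition of `P₅` whose splits form the star `{p,a},{p,b},{p,c},{p,d}`, every term `t` is read
as a pair of LETTER tensors `U_t` (symmetric, on the two letters in the slots of `S t`) and `W_t` (symmetric, on the three others),
in ONE labelling of the slots for all four fibres (long sides read in the slot orders `(b,c,d)`, `(a,c,d)`, `(a,b,d)`, `(a,b,c)`).

* `term_reading` — one term: `u v = U (v p) (v x)`, `w v = W (v q) (v r) (v s)`, `U`, `W` symmetric (cf. ✓ `two_term_exchange`).
* ★ `star_letter_reading` — all terms at once, plus, for the fibre sums `H_x(A,B|C,D,E) = Σ_{S t = {p,x}} U_t(A,B)·W_t(C,D,E)`: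
  the decomposition identity `H_a(A,B|C,D,E) + H_b(A,C|B,D,E) + H_c(A,D|B,C,E) + H_d(A,E|B,C,D) = P(A,B,C,D,E)` (`P` = the pattern
  `[letters distinct]`, written as the injectivity of the word), CLOSEDNESS of every fibre in the `4 + 4` letter form of
  ✓ `star_slack_sum` / ✓ `closed_vertex_sum` (from ✓ `star_shadow_exchange`), and the CROSS-SYMMETRY of `H_x − H_a` for `x = b, c, d`
  (from ✓ `star_shadows_congruent`) — i.e. exactly the hypotheses `h12 h34 h45 hC h34₃ h34₄ h45₄ hD₂ hD₃ hD₄ hfib` of ✓ `star_slack_sum`.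

No definitions, no `sorry`.  Honest framing: (L3) wiring brick, closes nothing; K1-on-the-star PAPER PASS, not kernel;
`LaplaceOptimalFive` OPEN · CONTESTED 72/120; `VP ≠ VNP` NOT proved.
-/

set_option linter.dupNamespace false

namespace Summit.ValiantsHypothesis.ValiantsHypothesis.Theorems.RigidityForcesSymmetryRankRigidMinimalRepr

namespace LaplaceFiveStar

open Finset LaplaceFiveSectorSplit

variable {N : ℕ}

/-- **Reading one side-symmetric pair-split term** in a given slot labelling `(p, x | q, r, s)`. [folklore] -/
theorem term_reading (p x q r s : Fin 5) (hpx : p ≠ x) (hqr : q ≠ r) (hqs : q ≠ s) (hrs : r ≠ s)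
    (u w : (Fin 5 → Fin 5) → ℂ)
    (hu : ∀ v v' : Fin 5 → Fin 5, v p = v' p → v x = v' x → u v = u v')
    (hw : ∀ v v' : Fin 5 → Fin 5, v q = v' q → v r = v' r → v s = v' s → w v = w v')
    (hus : ∀ v : Fin 5 → Fin 5, u (v ∘ ⇑(Equiv.swap p x)) = u v)
    (hwqr : ∀ v : Fin 5 → Fin 5, w (v ∘ ⇑(Equiv.swap q r)) = w v)
    (hwrs : ∀ v : Fin 5 → Fin 5, w (v ∘ ⇑(Equiv.swap r s)) = w v)
    (U : Fin 5 → Fin 5 → ℂ) (W : Fin 5 → Fin 5 → Fin 5 → ℂ)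
    (hU : U = fun y z => u (fun i => if i = p then y else z))
    (hW : W = fun y z o => w (fun i => if i = q then y else if i = r then z else if i = s then o else y)) :
    (∀ v : Fin 5 → Fin 5, u v = U (v p) (v x)) ∧ (∀ v : Fin 5 → Fin 5, w v = W (v q) (v r) (v s)) ∧
    (∀ y z : Fin 5, U y z = U z y) ∧ (∀ y z o : Fin 5, W y z o = W z y o) ∧ (∀ y z o : Fin 5, W y z o = W y o z) := by
  have hxp : x ≠ p := Ne.symm hpx
  have hrq : r ≠ q := Ne.symm hqr
  have hsq : s ≠ q := Ne.symm hqs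
  have hsr : s ≠ r := Ne.symm hrs
  refine ⟨fun v => ?_, fun v => ?_, fun y z => ?_, fun y z o => ?_, fun y z o => ?_⟩
  · rw [hU]; exact hu v _ (by simp) (by simp [hxp])
  · rw [hW]; exact hw v _ (by simp) (by simp [hrq]) (by simp [hsq, hsr])
  · rw [hU]
    have h1 : u (fun i => if i = p then z else y) = u ((fun i => if i = p then y else z) ∘ ⇑(Equiv.swap p x)) := by
      refine hu _ _ ?_ ?_
      · simp [Function.comp_apply, hxp]
      · simp [Function.comp_apply, hxp]
    show u _ = u _
    rw [h1, hus]
  · rw [hW]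
    have h1 : w (fun i => if i = q then z else if i = r then y else if i = s then o else z)
        = w ((fun i => if i = q then y else if i = r then z else if i = s then o else y) ∘ ⇑(Equiv.swap q r)) := by
      refine hw _ _ ?_ ?_ ?_
      · simp [Function.comp_apply, hrq]
      · simp [Function.comp_apply, hrq]
      · simp [Function.comp_apply, Equiv.swap_apply_def, hsq, hsr]
    show w _ = w _
    rw [h1, hwqr]
  · rw [hW]
    have h1 : w (fun i => if i = q then y else if i = r then o else if i = s then z else y)
        = w ((fun i => if i = q then y else if i = r then z else if i = s then o else y) ∘ ⇑(Equiv.swap r s)) := by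
      refine hw _ _ ?_ ?_ ?_
      · simp [Function.comp_apply, Equiv.swap_apply_def, hqr, hqs]
      · simp [Function.comp_apply, hrq, hsq, hsr]
      · simp [Function.comp_apply, hrq, hsq, hsr]
    show w _ = w _
    rw [h1, hwrs]

/-- **Reading a whole side-symmetric star decomposition in letter currency** (module docstring). [folklore] -/
theorem star_letter_reading (T : Finset (Fin N)) (S : Fin N → Finset (Fin 5))
    (u w : Fin N → (Fin 5 → Fin 5) → ℂ) (hdec : IsSplitDecomposition T S u w) (hsym : SideSymmetric T S u w)
    (p a b c d : Fin 5) (hpa : p ≠ a) (hpb : p ≠ b) (hpc : p ≠ c) (hpd : p ≠ d) (hab : a ≠ b) (hac : a ≠ c) (had : a ≠ d)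
    (hbc : b ≠ c) (hbd : b ≠ d) (hcd : c ≠ d)
    (hI : T.image S = {({p, a} : Finset (Fin 5)), {p, b}, {p, c}, {p, d}}) :
    ∃ (U : Fin N → Fin 5 → Fin 5 → ℂ) (W : Fin N → Fin 5 → Fin 5 → Fin 5 → ℂ),
      (∀ t ∈ T, (∀ y z : Fin 5, U t y z = U t z y) ∧ (∀ y z o : Fin 5, W t y z o = W t z y o) ∧
        (∀ y z o : Fin 5, W t y z o = W t y o z)) ∧
      (∀ t ∈ T, S t = {p, a} → ∀ v : Fin 5 → Fin 5, u t v = U t (v p) (v a) ∧ w t v = W t (v b) (v c) (v d)) ∧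
      (∀ t ∈ T, S t = {p, b} → ∀ v : Fin 5 → Fin 5, u t v = U t (v p) (v b) ∧ w t v = W t (v a) (v c) (v d)) ∧
      (∀ t ∈ T, S t = {p, c} → ∀ v : Fin 5 → Fin 5, u t v = U t (v p) (v c) ∧ w t v = W t (v a) (v b) (v d)) ∧
      (∀ t ∈ T, S t = {p, d} → ∀ v : Fin 5 → Fin 5, u t v = U t (v p) (v d) ∧ w t v = W t (v a) (v b) (v c)) ∧
      let Ha : Fin 5 → Fin 5 → Fin 5 → Fin 5 → Fin 5 → ℂ :=
        fun A B C D E => ∑ t ∈ T.filter (fun t => S t = {p, a}), U t A B * W t C D E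
      let Hb : Fin 5 → Fin 5 → Fin 5 → Fin 5 → Fin 5 → ℂ :=
        fun A B C D E => ∑ t ∈ T.filter (fun t => S t = {p, b}), U t A B * W t C D E
      let Hc : Fin 5 → Fin 5 → Fin 5 → Fin 5 → Fin 5 → ℂ :=
        fun A B C D E => ∑ t ∈ T.filter (fun t => S t = {p, c}), U t A B * W t C D E
      let Hd : Fin 5 → Fin 5 → Fin 5 → Fin 5 → Fin 5 → ℂ :=
        fun A B C D E => ∑ t ∈ T.filter (fun t => S t = {p, d}), U t A B * W t C D E
      (∀ A B C D E : Fin 5, Ha A B C D E + Hb A C B D E + Hc A D B C E + Hd A E B C D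
        = if Function.Injective (fun i : Fin 5 => if i = p then A else if i = a then B else if i = b then C
            else if i = c then D else E) then (1 : ℂ) else 0) ∧
      (∀ A B C D E : Fin 5, Ha A B C D E + Ha A C B D E + Ha A D C B E + Ha A E C D B
        = Ha B A C D E + Ha B C A D E + Ha B D C A E + Ha B E C D A) ∧
      (∀ A B C D E : Fin 5, Hb A B C D E + Hb A C B D E + Hb A D C B E + Hb A E C D B
        = Hb B A C D E + Hb B C A D E + Hb B D C A E + Hb B E C D A) ∧
      (∀ A B C D E : Fin 5, Hc A B C D E + Hc A C B D E + Hc A D C B E + Hc A E C D B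
        = Hc B A C D E + Hc B C A D E + Hc B D C A E + Hc B E C D A) ∧
      (∀ A B C D E : Fin 5, Hd A B C D E + Hd A C B D E + Hd A D C B E + Hd A E C D B
        = Hd B A C D E + Hd B C A D E + Hd B D C A E + Hd B E C D A) ∧
      (∀ A B C D E : Fin 5, Hb A B C D E - Ha A B C D E = Hb A C B D E - Ha A C B D E) ∧
      (∀ A B C D E : Fin 5, Hc A B C D E - Ha A B C D E = Hc A C B D E - Ha A C B D E) ∧
      (∀ A B C D E : Fin 5, Hd A B C D E - Ha A B C D E = Hd A C B D E - Ha A C B D E) := by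
  classical
  obtain ⟨hu, hw, hid⟩ := hdec
  -- the five slots exhaust `Fin 5`
  have hcover : ∀ i : Fin 5, i = p ∨ i = a ∨ i = b ∨ i = c ∨ i = d := by
    have hc5 : ({p, a, b, c, d} : Finset (Fin 5)).card = 5 := by
      rw [Finset.card_insert_of_notMem, Finset.card_insert_of_notMem, Finset.card_insert_of_notMem,
        Finset.card_pair hcd]
      · simp [hbc, hbd]
      · simp [hab, hac, had]
      · simp [hpa, hpb, hpc, hpd]
    have huniv := Finset.eq_univ_of_card _ (by rw [hc5]; simp)
    intro i
    have hi : i ∈ ({p, a, b, c, d} : Finset (Fin 5)) := by rw [huniv]; exact Finset.mem_univ i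
    simpa using hi
  -- the letter tensors
  let U : Fin N → Fin 5 → Fin 5 → ℂ := fun t y z => u t (fun i => if i = p then y else z)
  let ω₃ : Fin 5 → Fin 5 → Fin 5 → Fin 5 → Fin 5 → Fin 5 → (Fin 5 → Fin 5) :=
    fun q r s y z o i => if i = q then y else if i = r then z else if i = s then o else y
  let W : Fin N → Fin 5 → Fin 5 → Fin 5 → ℂ := fun t y z o =>
    if S t = {p, a} then w t (ω₃ b c d y z o) else if S t = {p, b} then w t (ω₃ a c d y z o)
    else if S t = {p, c} then w t (ω₃ a b d y z o) else w t (ω₃ a b c y z o)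
  -- generic fibre reading
  have fib : ∀ (x q r s : Fin 5), p ≠ x → p ≠ q → p ≠ r → p ≠ s → x ≠ q → x ≠ r → x ≠ s → q ≠ r → q ≠ s → r ≠ s →
      (∀ i : Fin 5, i = p ∨ i = x ∨ i = q ∨ i = r ∨ i = s) →
      ∀ t ∈ T, S t = {p, x} → (∀ y z o, W t y z o = w t (ω₃ q r s y z o)) →
        (∀ v : Fin 5 → Fin 5, u t v = U t (v p) (v x)) ∧ (∀ v : Fin 5 → Fin 5, w t v = W t (v q) (v r) (v s)) ∧
        (∀ y z : Fin 5, U t y z = U t z y) ∧ (∀ y z o : Fin 5, W t y z o = W t z y o) ∧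
        (∀ y z o : Fin 5, W t y z o = W t y o z) := by
    intro x q r s hpx hpq hpr hps hxq hxr hxs hqr hqs hrs hcov t ht hSt hWt
    have hu' : ∀ v v' : Fin 5 → Fin 5, v p = v' p → v x = v' x → u t v = u t v' :=
      fun v v' h1 h2 => hu t v v' fun i hi => by
        rw [hSt] at hi
        simp only [Finset.mem_insert, Finset.mem_singleton] at hi
        rcases hi with rfl | rfl
        · exact h1
        · exact h2
    have hw' : ∀ v v' : Fin 5 → Fin 5, v q = v' q → v r = v' r → v s = v' s → w t v = w t v' :=
      fun v v' h1 h2 h3 => hw t v v' fun i hi => by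
        rw [hSt] at hi
        simp only [Finset.mem_insert, Finset.mem_singleton, not_or] at hi
        rcases hcov i with h | h | h | h | h
        · exact absurd h hi.1
        · exact absurd h hi.2
        · rw [h]; exact h1
        · rw [h]; exact h2
        · rw [h]; exact h3
    have hus : ∀ v : Fin 5 → Fin 5, u t (v ∘ ⇑(Equiv.swap p x)) = u t v :=
      fun v => invUnder_swap_of_mem (A := S t) (hsym t ht).1 (by rw [hSt]; simp) (by rw [hSt]; simp) v
    have hwqr : ∀ v : Fin 5 → Fin 5, w t (v ∘ ⇑(Equiv.swap q r)) = w t v :=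
      fun v => invUnder_swap_of_not_mem (A := S t) (hsym t ht).2 (by rw [hSt]; simp [Ne.symm hpq, Ne.symm hxq])
        (by rw [hSt]; simp [Ne.symm hpr, Ne.symm hxr]) v
    have hwrs : ∀ v : Fin 5 → Fin 5, w t (v ∘ ⇑(Equiv.swap r s)) = w t v :=
      fun v => invUnder_swap_of_not_mem (A := S t) (hsym t ht).2 (by rw [hSt]; simp [Ne.symm hpr, Ne.symm hxr])
        (by rw [hSt]; simp [Ne.symm hps, Ne.symm hxs]) v
    have hWt' : W t = fun y z o => w t (fun i => if i = q then y else if i = r then z else if i = s then o else y) := by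
      funext y z o; exact hWt y z o
    exact term_reading p x q r s hpx hqr hqs hrs (u t) (w t) hu' hw' hus hwqr hwrs (U t) (W t) rfl hWt'
  -- distinct leaves give distinct splits
  have ne : ∀ x y : Fin 5, x ≠ y → p ≠ y → ({p, x} : Finset (Fin 5)) ≠ {p, y} := by
    intro x y hxy hpy h
    have hy : y ∈ ({p, x} : Finset (Fin 5)) := by rw [h]; simp
    simp only [Finset.mem_insert, Finset.mem_singleton] at hy
    rcases hy with hy | hy
    · exact hpy hy.symm
    · exact hxy hy.symm
  -- the four fibre readings
  have Ra : ∀ t ∈ T, S t = {p, a} → (∀ v : Fin 5 → Fin 5, u t v = U t (v p) (v a)) ∧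
      (∀ v : Fin 5 → Fin 5, w t v = W t (v b) (v c) (v d)) ∧ (∀ y z : Fin 5, U t y z = U t z y) ∧
      (∀ y z o : Fin 5, W t y z o = W t z y o) ∧ (∀ y z o : Fin 5, W t y z o = W t y o z) :=
    fun t ht hSt => fib a b c d hpa hpb hpc hpd hab hac had hbc hbd hcd hcover t ht hSt
      (fun y z o => by simp only [W, hSt, if_true])
  have Rb : ∀ t ∈ T, S t = {p, b} → (∀ v : Fin 5 → Fin 5, u t v = U t (v p) (v b)) ∧
      (∀ v : Fin 5 → Fin 5, w t v = W t (v a) (v c) (v d)) ∧ (∀ y z : Fin 5, U t y z = U t z y) ∧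
      (∀ y z o : Fin 5, W t y z o = W t z y o) ∧ (∀ y z o : Fin 5, W t y z o = W t y o z) :=
    fun t ht hSt => fib b a c d hpb hpa hpc hpd (Ne.symm hab) hbc hbd hac had hcd
      (fun i => by rcases hcover i with h | h | h | h | h <;> simp [h]) t ht hSt
      (fun y z o => by simp only [W, hSt, (ne b a (Ne.symm hab) hpa), if_false, if_true])
  have Rc : ∀ t ∈ T, S t = {p, c} → (∀ v : Fin 5 → Fin 5, u t v = U t (v p) (v c)) ∧
      (∀ v : Fin 5 → Fin 5, w t v = W t (v a) (v b) (v d)) ∧ (∀ y z : Fin 5, U t y z = U t z y) ∧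
      (∀ y z o : Fin 5, W t y z o = W t z y o) ∧ (∀ y z o : Fin 5, W t y z o = W t y o z) :=
    fun t ht hSt => fib c a b d hpc hpa hpb hpd (Ne.symm hac) (Ne.symm hbc) hcd hab had hbd
      (fun i => by rcases hcover i with h | h | h | h | h <;> simp [h]) t ht hSt
      (fun y z o => by simp only [W, hSt, (ne c a (Ne.symm hac) hpa), (ne c b (Ne.symm hbc) hpb), if_false, if_true])
  have Rd : ∀ t ∈ T, S t = {p, d} → (∀ v : Fin 5 → Fin 5, u t v = U t (v p) (v d)) ∧
      (∀ v : Fin 5 → Fin 5, w t v = W t (v a) (v b) (v c)) ∧ (∀ y z : Fin 5, U t y z = U t z y) ∧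
      (∀ y z o : Fin 5, W t y z o = W t z y o) ∧ (∀ y z o : Fin 5, W t y z o = W t y o z) :=
    fun t ht hSt => fib d a b c hpd hpa hpb hpc (Ne.symm had) (Ne.symm hbd) (Ne.symm hcd) hab hac hbc
      (fun i => by rcases hcover i with h | h | h | h | h <;> simp [h]) t ht hSt
      (fun y z o => by
        simp only [W, hSt, (ne d a (Ne.symm had) hpa), (ne d b (Ne.symm hbd) hpb), (ne d c (Ne.symm hcd) hpc), if_false])
  -- every term lies on one of the four fibres
  have hfibre : ∀ t ∈ T, S t = {p, a} ∨ S t = {p, b} ∨ S t = {p, c} ∨ S t = {p, d} := by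
    intro t ht
    have h := Finset.mem_image_of_mem S ht
    rw [hI] at h
    simpa only [Finset.mem_insert, Finset.mem_singleton] using h
  refine ⟨U, W, fun t ht => ?_, fun t ht hSt v => ⟨(Ra t ht hSt).1 v, (Ra t ht hSt).2.1 v⟩,
    fun t ht hSt v => ⟨(Rb t ht hSt).1 v, (Rb t ht hSt).2.1 v⟩, fun t ht hSt v => ⟨(Rc t ht hSt).1 v, (Rc t ht hSt).2.1 v⟩,
    fun t ht hSt v => ⟨(Rd t ht hSt).1 v, (Rd t ht hSt).2.1 v⟩, ?_⟩
  · rcases hfibre t ht with h | h | h | h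
    · exact ⟨(Ra t ht h).2.2.1, (Ra t ht h).2.2.2.1, (Ra t ht h).2.2.2.2⟩
    · exact ⟨(Rb t ht h).2.2.1, (Rb t ht h).2.2.2.1, (Rb t ht h).2.2.2.2⟩
    · exact ⟨(Rc t ht h).2.2.1, (Rc t ht h).2.2.2.1, (Rc t ht h).2.2.2.2⟩
    · exact ⟨(Rd t ht h).2.2.1, (Rd t ht h).2.2.2.1, (Rd t ht h).2.2.2.2⟩
  intro Ha Hb Hc Hd
  -- evaluation of fibre sums at words
  have evA : ∀ v : Fin 5 → Fin 5, (∑ t ∈ T.filter (fun t => S t = {p, a}), u t v * w t v)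
      = ∑ t ∈ T.filter (fun t => S t = {p, a}), U t (v p) (v a) * W t (v b) (v c) (v d) :=
    fun v => Finset.sum_congr rfl fun t ht => by
      obtain ⟨htT, hSt⟩ := Finset.mem_filter.mp ht
      rw [(Ra t htT hSt).1 v, (Ra t htT hSt).2.1 v]
  have evB : ∀ v : Fin 5 → Fin 5, (∑ t ∈ T.filter (fun t => S t = {p, b}), u t v * w t v)
      = ∑ t ∈ T.filter (fun t => S t = {p, b}), U t (v p) (v b) * W t (v a) (v c) (v d) :=
    fun v => Finset.sum_congr rfl fun t ht => by
      obtain ⟨htT, hSt⟩ := Finset.mem_filter.mp ht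
      rw [(Rb t htT hSt).1 v, (Rb t htT hSt).2.1 v]
  have evC : ∀ v : Fin 5 → Fin 5, (∑ t ∈ T.filter (fun t => S t = {p, c}), u t v * w t v)
      = ∑ t ∈ T.filter (fun t => S t = {p, c}), U t (v p) (v c) * W t (v a) (v b) (v d) :=
    fun v => Finset.sum_congr rfl fun t ht => by
      obtain ⟨htT, hSt⟩ := Finset.mem_filter.mp ht
      rw [(Rc t htT hSt).1 v, (Rc t htT hSt).2.1 v]
  have evD : ∀ v : Fin 5 → Fin 5, (∑ t ∈ T.filter (fun t => S t = {p, d}), u t v * w t v)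
      = ∑ t ∈ T.filter (fun t => S t = {p, d}), U t (v p) (v d) * W t (v a) (v b) (v c) :=
    fun v => Finset.sum_congr rfl fun t ht => by
      obtain ⟨htT, hSt⟩ := Finset.mem_filter.mp ht
      rw [(Rd t htT hSt).1 v, (Rd t htT hSt).2.1 v]
  have distinct : p ≠ a ∧ p ≠ b ∧ p ≠ c ∧ p ≠ d ∧ a ≠ p ∧ b ≠ p ∧ c ≠ p ∧ d ≠ p ∧ a ≠ b ∧ a ≠ c ∧ a ≠ d ∧ b ≠ a ∧ c ≠ a ∧
      d ≠ a ∧ b ≠ c ∧ b ≠ d ∧ c ≠ b ∧ d ≠ b ∧ c ≠ d ∧ d ≠ c :=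
    ⟨hpa, hpb, hpc, hpd, hpa.symm, hpb.symm, hpc.symm, hpd.symm, hab, hac, had, hab.symm, hac.symm, had.symm, hbc, hbd,
      hbc.symm, hbd.symm, hcd, hcd.symm⟩
  obtain ⟨hpa, hpb, hpc, hpd, hap, hbp, hcp, hdp, hab, hac, had, hba, hca, hda, hbc, hbd, hcb, hdb, hcd, hdc⟩ := distinct
  refine ⟨fun A B C D E => ?_, fun A B C D E => ?_, fun A B C D E => ?_, fun A B C D E => ?_, fun A B C D E => ?_,
    fun A B C D E => ?_, fun A B C D E => ?_, fun A B C D E => ?_⟩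
  · -- the decomposition identity, read fibre by fibre
    have h := hid (fun i : Fin 5 => if i = p then A else if i = a then B else if i = b then C else if i = c then D else E)
    rw [← Finset.sum_fiberwise_of_maps_to (g := S) (fun t (ht : t ∈ T) => Finset.mem_image_of_mem S ht), hI,
      Finset.sum_insert, Finset.sum_insert, Finset.sum_insert, Finset.sum_singleton, evA, evB, evC, evD] at h
    · simp only [hap, hbp, hcp, hdp, hba, hca, hda, hcb, hdb, hdc, if_true, if_false] at h
      rw [add_assoc, add_assoc]
      exact h
    · simp only [Finset.mem_singleton]; exact ne c d hcd hpd
    · simp only [Finset.mem_insert, Finset.mem_singleton, not_or]; exact ⟨ne b c hbc hpc, ne b d hbd hpd⟩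
    · simp only [Finset.mem_insert, Finset.mem_singleton, not_or]; exact ⟨ne a b hab hpb, ne a c hac hpc, ne a d had hpd⟩
  · have h := star_shadow_exchange p a b c d hpa hpb hpc hpd hab hac had hbc hbd hcd T S u w ⟨hu, hw, hid⟩ hsym hI A B C D E
    simp only [evA, hap, hbp, hcp, hdp, hba, hca, hda, hcb, hdb, hdc, if_true, if_false] at h
    exact h
  · have hI' : T.image S = {({p, b} : Finset (Fin 5)), {p, a}, {p, c}, {p, d}} := by
      rw [hI]; ext X; simp only [Finset.mem_insert, Finset.mem_singleton]; tauto
    have h := star_shadow_exchange p b a c d hpb hpa hpc hpd hba hbc hbd hac had hcd T S u w ⟨hu, hw, hid⟩ hsym hI' A B C D E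
    simp only [evB, hap, hab, hbp, hcp, hcb, hca, hdp, hdb, hda, hdc, if_true, if_false] at h
    exact h
  · have hI' : T.image S = {({p, c} : Finset (Fin 5)), {p, a}, {p, b}, {p, d}} := by
      rw [hI]; ext X; simp only [Finset.mem_insert, Finset.mem_singleton]; tauto
    have h := star_shadow_exchange p c a b d hpc hpa hpb hpd hca hcb hcd hab had hbd T S u w ⟨hu, hw, hid⟩ hsym hI' A B C D E
    simp only [evC, hap, hac, hbp, hbc, hba, hcp, hdp, hdc, hda, hdb, if_true, if_false] at h
    exact h
  · have hI' : T.image S = {({p, d} : Finset (Fin 5)), {p, a}, {p, b}, {p, c}} := by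
      rw [hI]; ext X; simp only [Finset.mem_insert, Finset.mem_singleton]; tauto
    have h := star_shadow_exchange p d a b c hpd hpa hpb hpc hda hdb hdc hab hac hbc T S u w ⟨hu, hw, hid⟩ hsym hI' A B C D E
    simp only [evD, hap, had, hbp, hbd, hba, hcp, hcd, hca, hcb, hdp, if_true, if_false] at h
    exact h
  · have h := star_shadows_congruent p a b c d hpa hpb hpc hpd hab hac had hbc hbd hcd T S u w ⟨hu, hw, hid⟩ hsym hI A B C D E
    simp only [evA, evB, hap, hbp, hcp, hdp, hba, hca, hda, hcb, hdb, hdc, if_true, if_false] at h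
    exact h
  · have hI' : T.image S = {({p, a} : Finset (Fin 5)), {p, c}, {p, b}, {p, d}} := by
      rw [hI]; ext X; simp only [Finset.mem_insert, Finset.mem_singleton]; tauto
    have h := star_shadows_congruent p a c b d hpa hpc hpb hpd hac hab had hcb hcd hbd T S u w ⟨hu, hw, hid⟩ hsym hI' A B C D E
    simp only [evA, evC, hap, hbp, hba, hbc, hcp, hca, hdp, hda, hdc, hdb, if_true, if_false] at h
    -- normalise the long letters of fibre `a` (read in the order `b, c, d`)
    have e1 : (∑ t ∈ T.filter (fun t => S t = {p, a}), U t A C * W t D B E)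
        = ∑ t ∈ T.filter (fun t => S t = {p, a}), U t A C * W t B D E :=
      Finset.sum_congr rfl fun t ht => by
        obtain ⟨htT, hSt⟩ := Finset.mem_filter.mp ht
        rw [(Ra t htT hSt).2.2.2.1 D B E]
    have e2 : (∑ t ∈ T.filter (fun t => S t = {p, a}), U t A B * W t D C E)
        = ∑ t ∈ T.filter (fun t => S t = {p, a}), U t A B * W t C D E :=
      Finset.sum_congr rfl fun t ht => by
        obtain ⟨htT, hSt⟩ := Finset.mem_filter.mp ht
        rw [(Ra t htT hSt).2.2.2.1 D C E]
    rw [e1, e2] at h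
    exact h
  · have hI' : T.image S = {({p, a} : Finset (Fin 5)), {p, d}, {p, b}, {p, c}} := by
      rw [hI]; ext X; simp only [Finset.mem_insert, Finset.mem_singleton]
      constructor
      · rintro (h | h | h | h)
        · exact Or.inl h
        · exact Or.inr (Or.inr (Or.inl h))
        · exact Or.inr (Or.inr (Or.inr h))
        · exact Or.inr (Or.inl h)
      · rintro (h | h | h | h)
        · exact Or.inl h
        · exact Or.inr (Or.inr (Or.inr h))
        · exact Or.inr (Or.inl h)
        · exact Or.inr (Or.inr (Or.inl h))
    have h := star_shadows_congruent p a d b c hpa hpd hpb hpc had hab hac hdb hdc hbc T S u w ⟨hu, hw, hid⟩ hsym hI' A B C D E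
    simp only [evA, evD, hap, hbp, hba, hbd, hcp, hca, hcd, hcb, hdp, hda, if_true, if_false] at h
    have e1 : (∑ t ∈ T.filter (fun t => S t = {p, a}), U t A C * W t D E B)
        = ∑ t ∈ T.filter (fun t => S t = {p, a}), U t A C * W t B D E :=
      Finset.sum_congr rfl fun t ht => by
        obtain ⟨htT, hSt⟩ := Finset.mem_filter.mp ht
        rw [(Ra t htT hSt).2.2.2.2 D E B, (Ra t htT hSt).2.2.2.1 D B E]
    have e2 : (∑ t ∈ T.filter (fun t => S t = {p, a}), U t A B * W t D E C)
        = ∑ t ∈ T.filter (fun t => S t = {p, a}), U t A B * W t C D E :=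
      Finset.sum_congr rfl fun t ht => by
        obtain ⟨htT, hSt⟩ := Finset.mem_filter.mp ht
        rw [(Ra t htT hSt).2.2.2.2 D E C, (Ra t htT hSt).2.2.2.1 D C E]
    rw [e1, e2] at h
    exact h
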